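import Literature.NumberTheory.ConnesConsani2023.ZetaCyclesSemilocalFormProofs
import Mathlib.Analysis.SpecialFunctions.JapaneseBracket
import HarnessLib

/-!
# `ZetaCyclesSemilocalForm`: the exponentials `U^n` lie in `Dom(QW_λ)` (eq. (2.13)) and the monotone
# half of Cor. 2.4

RH-FREE (label, line 1).  Second proof file of
`Literature/NumberTheory/ConnesConsani2023/ZetaCyclesSemilocalForm.lean` (Connes–Consani, *Spectral
triples and ζ-cycles*, Enseign. Math. **69** (2023) [cite: ConnesConsani2023, Lemma 2.2 eq. (2.13) p. 104; Cor. 2.4 p. 106]).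
Everything is PROVED; no definition, no named fact.

* §I eq. (2.13) (p. 104, arXiv chunk p0006:L88–p0007:L2): the transform of Yoshida's exponential
  `χ_n = (2a)^{-1/2} e^{iπnx/a} 1_{[−a,a]}` (`= U^n/√(2a)` in the paper's notation, `a = log λ`) on the
  critical line, `χ̂_n(1/2+it) = (2a)^{-1/2} ∫_{−a}^{a} e^{i(πn/a + t)x} dx`, with the two bounds
  `|χ̂_n| ≤ √(2a)` and `|χ̂_n| ≤ (2a)^{-1/2} · 2/|πn/a + t|` ("`Û^n(s) = O(1/|s|)`"), whence the log-energy
  `‖χ̂_n‖₁` is finite: "`U^n` belongs to the domain of `Q_∞`" (`chi_mem_formDomain`).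
* §J the form domain is a linear space, so `E_N = Yoshida1992.W a N ⊆ formDomain a`
  (`mem_formDomain_of_mem_W`); and the MONOTONE HALF of Cor. 2.4: the smallest eigenvalues
  `finiteSectionMin a N` of the finite sections decrease in `N` (`finiteSectionMin_antitone`), are bounded
  below by the lower bound of the form (`formLowerBound_le_finiteSectionMin`, using the proved
  `semilocalWeilForm_lower_bound`), hence converge, to a limit `≥ formLowerBound a`
  (`tendsto_finiteSectionMin_iInf`).  The reverse inequality — the limit IS the lower bound — is
  Cor. 2.4 proper (named fact `cor_2_4`) and rests on the core property Lemma 2.2 (named fact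
  `lemma_2_2`); neither is discharged here.
Nothing here bears on the truth of the Riemann hypothesis.
-/

noncomputable section

open Complex Filter Set MeasureTheory
open scoped Real Topology ENNReal ComplexConjugate

namespace Literature.NumberTheory.ConnesConsani2023

open Literature.NumberTheory.LFunctions

/-! ## §I Eq. (2.13): the exponentials `U^n` lie in the form domain; finite sections `E_N ⊆ Dom(QW_λ)` -/

section FiniteSections

variable {a : ℝ}

/-- The log weight is non-negative. [cite: ConnesConsani2023, proof of Lemma 2.2 (the weight 1 + log(1+s²) of (2.16)), p. 105 (arXiv chunk p0007:L24)] -/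
private theorem logWeight_nonneg' (t : ℝ) : 0 ≤ 1 + Real.log (1 + t ^ 2) := by
  have := Real.log_nonneg (show (1 : ℝ) ≤ 1 + t ^ 2 by nlinarith [sq_nonneg t])
  linarith

/-- The transform of Yoshida's exponential on the critical line (eq. (2.13) before evaluation):
`χ̂_n(1/2 + it) = (2a)^{-1/2} ∫_{−a}^{a} e^{i(πn/a + t)x} dx`. [cite: ConnesConsani2023, proof of Lemma 2.2 eq. (2.13), p. 104 (arXiv chunk p0006:L88–L94)] -/
theorem weilMellin_chi_half_line (ha : 0 < a) (n : ℤ) (t : ℝ) :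
    weilMellin (Yoshida1992.chi a n) (1 / 2 + t * I) =
      ((1 / Real.sqrt (2 * a) : ℝ) : ℂ) * ∫ x in (-a)..a, cexp (((π * n / a + t : ℝ) : ℂ) * I * x) := by
  unfold weilMellin Yoshida1992.chi
  rw [show (fun x : ℝ ↦ (Icc (-a) a).indicator (Yoshida1992.chiCore a n) x *
        cexp ((1 / 2 + (t : ℂ) * I - 1 / 2) * x)) =
      (Icc (-a) a).indicator (fun x : ℝ ↦ Yoshida1992.chiCore a n x *
        cexp ((1 / 2 + (t : ℂ) * I - 1 / 2) * x)) by
    funext x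
    by_cases hx : x ∈ Icc (-a) a
    · simp [indicator_of_mem hx]
    · simp [indicator_of_notMem hx]]
  rw [integral_indicator measurableSet_Icc, integral_Icc_eq_integral_Ioc,
    ← intervalIntegral.integral_of_le (by linarith), ← intervalIntegral.integral_const_mul]
  refine intervalIntegral.integral_congr fun x _ ↦ ?_
  simp only [Yoshida1992.chiCore]
  rw [mul_assoc, ← Complex.exp_add]
  congr 2
  push_cast
  ring

/-- The trivial bound `|χ̂_n(1/2+it)| ≤ √(2a)` (`|χ_n| = (2a)^{-1/2}` on a window of length `2a`). [cite: ConnesConsani2023, proof of Lemma 2.2 eq. (2.13), p. 104 (arXiv chunk p0006:L88–L94)] -/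
theorem norm_weilMellin_chi_le_sqrt (ha : 0 < a) (n : ℤ) (t : ℝ) :
    ‖weilMellin (Yoshida1992.chi a n) (1 / 2 + t * I)‖ ≤ Real.sqrt (2 * a) := by
  have hA : 0 < 2 * a := by positivity
  rw [weilMellin_chi_half_line ha n t, norm_mul, Complex.norm_real, Real.norm_eq_abs,
    abs_of_pos (by positivity)]
  have hb : ‖∫ x in (-a)..a, cexp (((π * n / a + t : ℝ) : ℂ) * I * x)‖ ≤ 1 * |a - (-a)| := by
    refine intervalIntegral.norm_integral_le_of_norm_le_const fun x _ ↦ ?_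
    rw [Complex.norm_exp]
    have : ((((π * n / a + t : ℝ) : ℂ) * I * x)).re = 0 := by
      simp [Complex.mul_re]
    rw [this, Real.exp_zero]
  have h2a : |a - (-a)| = 2 * a := by rw [sub_neg_eq_add, ← two_mul, abs_of_pos (by positivity)]
  rw [h2a, one_mul] at hb
  have hsq : Real.sqrt (2 * a) * Real.sqrt (2 * a) = 2 * a := Real.mul_self_sqrt (by positivity)
  calc 1 / Real.sqrt (2 * a) * ‖∫ x in (-a)..a, cexp (((π * n / a + t : ℝ) : ℂ) * I * x)‖
      ≤ 1 / Real.sqrt (2 * a) * (2 * a) := mul_le_mul_of_nonneg_left hb (by positivity)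
    _ = Real.sqrt (2 * a) := by
        have hne : Real.sqrt (2 * a) ≠ 0 := (Real.sqrt_pos.2 hA).ne'
        field_simp
        linarith [Real.sq_sqrt hA.le, Real.mul_self_sqrt hA.le]

/-- The decay bound `|χ̂_n(1/2+it)| ≤ (2a)^{-1/2} · 2/|πn/a + t|` off the resonance (eq. (2.13):
`Û^n(s) = O(1/|s|)`). [cite: ConnesConsani2023, proof of Lemma 2.2 eq. (2.13), p. 104 (arXiv chunk p0006:L88–L94)] -/
theorem norm_weilMellin_chi_le_inv (ha : 0 < a) (n : ℤ) {t : ℝ} (ht : π * n / a + t ≠ 0) :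
    ‖weilMellin (Yoshida1992.chi a n) (1 / 2 + t * I)‖ ≤
      1 / Real.sqrt (2 * a) * (2 / |π * n / a + t|) := by
  rw [weilMellin_chi_half_line ha n t, norm_mul, Complex.norm_real, Real.norm_eq_abs,
    abs_of_pos (by positivity : 0 < 1 / Real.sqrt (2 * a))]
  refine mul_le_mul_of_nonneg_left ?_ (by positivity)
  set c : ℂ := ((π * n / a + t : ℝ) : ℂ) * I with hc
  have hc0 : c ≠ 0 := by
    rw [hc]
    exact mul_ne_zero (by exact_mod_cast ht) Complex.I_ne_zero
  have hnc : ‖c‖ = |π * n / a + t| := by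
    rw [hc, norm_mul, Complex.norm_I, mul_one, Complex.norm_real, Real.norm_eq_abs]
  rw [integral_exp_mul_complex hc0, norm_div, hnc]
  refine div_le_div_of_nonneg_right ?_ (abs_nonneg _)
  refine (norm_sub_le _ _).trans ?_
  have h1 : ∀ y : ℝ, ‖cexp (c * y)‖ = 1 := fun y ↦ by
    rw [Complex.norm_exp, hc]
    have : ((((π * n / a + t : ℝ) : ℂ) * I * y)).re = 0 := by simp [Complex.mul_re]
    rw [this, Real.exp_zero]
  rw [h1, h1]
  norm_num

/-- `χ_n` is square integrable with `∫ |χ_n|² = 1` written as integrability of the indicator. [cite: ConnesConsani2023, Prop. 2.1 (χ_n ∈ L²([λ⁻¹,λ], d*u); arXiv chunk p0006:L88; p. 104)] -/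
theorem memLp_chi (a : ℝ) (n : ℤ) : MemLp (Yoshida1992.chi a n) 2 volume := by
  have hmeas : AEStronglyMeasurable (Yoshida1992.chi a n) volume :=
    ((Yoshida1992.contDiff_chiCore a n).continuous.aestronglyMeasurable).indicator measurableSet_Icc
  rw [memLp_two_iff_integrable_sq_norm hmeas]
  have e : (fun x ↦ ‖Yoshida1992.chi a n x‖ ^ 2) =
      (Icc (-a) a).indicator (fun x ↦ ‖Yoshida1992.chiCore a n x‖ ^ 2) := by
    funext x
    by_cases hx : x ∈ Icc (-a) a
    · simp [Yoshida1992.chi, indicator_of_mem hx]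
    · simp [Yoshida1992.chi, indicator_of_notMem hx]
  rw [e, integrable_indicator_iff measurableSet_Icc]
  exact ((Yoshida1992.contDiff_chiCore a n).continuous.norm.pow 2).continuousOn.integrableOn_compact
    isCompact_Icc

/-- `χ_n` is supported in the window. [cite: ConnesConsani2023, Prop. 2.1 (functions vanishing outside [λ⁻¹, λ]; arXiv chunk p0006:L68; p. 103)] -/
theorem support_chi_subset (a : ℝ) (n : ℤ) :
    Function.support (Yoshida1992.chi a n) ⊆ Icc (-a) a := by
  unfold Yoshida1992.chi
  exact Set.support_indicator_subset

/-- `log y ≤ 4 y^{1/4}`-type bound: `1 + log(1 + t²) ≤ 5 (1 + t²)^{1/4}`. [folklore] -/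
private theorem logWeight_le_rpow (t : ℝ) :
    1 + Real.log (1 + t ^ 2) ≤ 5 * (1 + t ^ 2) ^ ((1 : ℝ) / 4) := by
  have h1 : (1 : ℝ) ≤ 1 + t ^ 2 := by nlinarith [sq_nonneg t]
  set y : ℝ := (1 + t ^ 2) ^ ((1 : ℝ) / 4) with hy
  have hy1 : 1 ≤ y := Real.one_le_rpow h1 (by norm_num)
  have hlog : Real.log (1 + t ^ 2) = 4 * Real.log y := by
    rw [hy, Real.log_rpow (by positivity)]
    ring
  have hly : Real.log y ≤ y - 1 := Real.log_le_sub_one_of_pos (by positivity)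
  rw [hlog]
  linarith

/-- Integrability of the majorant `(1 + |s|)^{-3/2}` shifted. [folklore] -/
private theorem integrable_shift_rpow (c : ℝ) :
    Integrable fun t : ℝ ↦ (1 + |t + c|) ^ (-(3 / 2 : ℝ)) := by
  have h := (integrable_one_add_norm (E := ℝ) (μ := volume) (r := 3 / 2)
    (by rw [Module.finrank_self]; norm_num))
  have h2 := h.comp_add_right c
  refine h2.congr (Eventually.of_forall fun t ↦ ?_)
  simp only [Real.norm_eq_abs]

/-- **Eq. (2.13): `U^n` belongs to the domain of `Q_∞`** — the log-energy of `χ_n` is finite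
(`|Û^n(s)|² ∂θ` is absolutely integrable since `Û^n(s) = O(1/|s|)`). [cite: ConnesConsani2023, proof of Lemma 2.2 eq. (2.13) and the sentence after it, p. 104 (arXiv chunk p0006:L88–p0007:L2)] -/
theorem logSobolevEnergy_chi_lt_top (ha : 0 < a) (n : ℤ) :
    logSobolevEnergy (Yoshida1992.chi a n) < ∞ := by
  set c : ℝ := π * n / a with hc
  -- majorant: `K (1 + |t + c|)^{-3/2}` with `K = 5 · 2(2a + 2/a) (1 + |c|)^{1/2}`... we use a cruder route:
  -- |χ̂|² ≤ min(2a, 2/(a (t+c)²)) ≤ (4a + 4/a)/(1 + (t+c)²) and (1+log(1+t²)) ≤ 5(1+t²)^{1/4} ≤ 5 (1+|c|)^{1/2} (1+|t+c|)^{1/2}.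
  have hA : 0 < 2 * a := by positivity
  have hmaj : ∀ t : ℝ, ‖weilMellin (Yoshida1992.chi a n) (1 / 2 + t * I)‖ ^ 2 ≤
      (4 * a + 4 / a) / (1 + (t + c) ^ 2) := by
    intro t
    have hsq := norm_weilMellin_chi_le_sqrt ha n t
    have hnn := norm_nonneg (weilMellin (Yoshida1992.chi a n) (1 / 2 + t * I))
    by_cases hsmall : (t + c) ^ 2 ≤ 1
    · -- use the trivial bound
      have h1 : ‖weilMellin (Yoshida1992.chi a n) (1 / 2 + t * I)‖ ^ 2 ≤ 2 * a := by
        calc _ ≤ Real.sqrt (2 * a) ^ 2 := pow_le_pow_left₀ hnn hsq 2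
          _ = 2 * a := Real.sq_sqrt hA.le
      rw [le_div_iff₀ (by positivity)]
      have h4a : 0 < 4 / a := by positivity
      nlinarith
    · rw [not_le] at hsmall
      have hne : π * n / a + t ≠ 0 := by
        intro h0
        have : (t + c) ^ 2 = 0 := by rw [hc, add_comm, h0]; ring
        linarith
      have hinv := norm_weilMellin_chi_le_inv ha n hne
      have habs : |π * n / a + t| = |t + c| := by rw [hc, add_comm]
      rw [habs] at hinv
      have hpos : 0 < |t + c| := by
        rw [abs_pos]; intro h0; rw [h0] at hsmall; norm_num at hsmall
      have h1 : ‖weilMellin (Yoshida1992.chi a n) (1 / 2 + t * I)‖ ^ 2 ≤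
          (1 / Real.sqrt (2 * a) * (2 / |t + c|)) ^ 2 :=
        pow_le_pow_left₀ hnn hinv 2
      have h2 : (1 / Real.sqrt (2 * a) * (2 / |t + c|)) ^ 2 = 2 / (a * (t + c) ^ 2) := by
        rw [mul_pow, div_pow, div_pow, one_pow, Real.sq_sqrt hA.le, sq_abs]
        field_simp
      rw [h2] at h1
      refine h1.trans ?_
      rw [div_le_div_iff₀ (by positivity) (by positivity)]
      have e3 : (4 * a + 4 / a) * (a * (t + c) ^ 2) = (4 * a ^ 2 + 4) * (t + c) ^ 2 := by
        field_simp
      rw [e3]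
      nlinarith [hsmall, sq_nonneg a, sq_nonneg (t + c)]
  have hlog : ∀ t : ℝ, 1 + Real.log (1 + t ^ 2) ≤
      5 * Real.sqrt (1 + |c|) * (1 + |t + c|) ^ ((1 : ℝ) / 2) := by
    intro t
    refine (logWeight_le_rpow t).trans ?_
    -- (1+t²)^{1/4} ≤ (1+|t|)^{1/2} ≤ ((1+|c|)(1+|t+c|))^{1/2}
    have h1 : (1 + t ^ 2) ^ ((1 : ℝ) / 4) ≤ ((1 + |c|) * (1 + |t + c|)) ^ ((1 : ℝ) / 2) := by
      have e : ((1 + |c|) * (1 + |t + c|)) ^ ((1 : ℝ) / 2) =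
          (((1 + |c|) * (1 + |t + c|)) ^ (2 : ℝ)) ^ ((1 : ℝ) / 4) := by
        rw [← Real.rpow_mul (by positivity)]; norm_num
      rw [e]
      refine Real.rpow_le_rpow (by positivity) ?_ (by norm_num)
      have ht : |t| ≤ |t + c| + |c| := by simpa using abs_sub (t + c) c
      rw [Real.rpow_two]
      nlinarith [sq_abs t, abs_nonneg t, abs_nonneg c, abs_nonneg (t + c),
        mul_nonneg (abs_nonneg c) (abs_nonneg (t + c))]
    have h2 : ((1 + |c|) * (1 + |t + c|)) ^ ((1 : ℝ) / 2) =
        Real.sqrt (1 + |c|) * (1 + |t + c|) ^ ((1 : ℝ) / 2) := by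
      rw [Real.mul_rpow (by positivity) (by positivity), Real.sqrt_eq_rpow]
    rw [h2] at h1
    linarith
  -- assemble a single integrable majorant
  set K : ℝ := (4 * a + 4 / a) * (5 * Real.sqrt (1 + |c|)) * 2 with hK
  have hKnn : 0 ≤ K := by positivity
  have hpt : ∀ t : ℝ, ‖weilMellin (Yoshida1992.chi a n) (1 / 2 + t * I)‖ ^ 2 *
      (1 + Real.log (1 + t ^ 2)) ≤ K * (1 + |t + c|) ^ (-(3 / 2 : ℝ)) := by
    intro t
    have hw := logWeight_nonneg' t
    have hm := hmaj t
    have hl := hlog t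
    have hs : 0 ≤ 1 + |t + c| := by positivity
    -- (1+(t+c)²)⁻¹ ≤ 2 (1+|t+c|)⁻² and combine exponents: (1+|s|)^{-2} (1+|s|)^{1/2} = (1+|s|)^{-3/2}
    have hstep1 : ‖weilMellin (Yoshida1992.chi a n) (1 / 2 + t * I)‖ ^ 2 * (1 + Real.log (1 + t ^ 2))
        ≤ (4 * a + 4 / a) / (1 + (t + c) ^ 2) * (5 * Real.sqrt (1 + |c|) * (1 + |t + c|) ^ ((1 : ℝ) / 2)) :=
      mul_le_mul hm hl hw (by positivity)
    refine hstep1.trans ?_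
    have hq : 1 / (1 + (t + c) ^ 2) ≤ 2 * (1 + |t + c|) ^ (-(2 : ℝ)) := by
      rw [Real.rpow_neg hs, Real.rpow_two, ← div_eq_mul_inv, div_le_div_iff₀ (by positivity) (by positivity)]
      nlinarith [sq_abs (t + c), abs_nonneg (t + c), sq_nonneg (|t + c| - 1)]
    have hexp : (1 + |t + c|) ^ (-(2 : ℝ)) * (1 + |t + c|) ^ ((1 : ℝ) / 2) =
        (1 + |t + c|) ^ (-(3 / 2 : ℝ)) := by
      rw [← Real.rpow_add (by positivity)]; norm_num
    calc (4 * a + 4 / a) / (1 + (t + c) ^ 2) * (5 * Real.sqrt (1 + |c|) * (1 + |t + c|) ^ ((1 : ℝ) / 2))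
        = (4 * a + 4 / a) * (5 * Real.sqrt (1 + |c|)) *
            (1 / (1 + (t + c) ^ 2) * (1 + |t + c|) ^ ((1 : ℝ) / 2)) := by ring
      _ ≤ (4 * a + 4 / a) * (5 * Real.sqrt (1 + |c|)) *
            (2 * (1 + |t + c|) ^ (-(2 : ℝ)) * (1 + |t + c|) ^ ((1 : ℝ) / 2)) := by
          gcongr
      _ = K * (1 + |t + c|) ^ (-(3 / 2 : ℝ)) := by rw [hK, ← hexp]; ring
  have hint : Integrable fun t : ℝ ↦ K * (1 + |t + c|) ^ (-(3 / 2 : ℝ)) :=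
    (integrable_shift_rpow c).const_mul K
  unfold logSobolevEnergy
  calc ∫⁻ s : ℝ, ENNReal.ofReal (‖weilMellin (Yoshida1992.chi a n) (1 / 2 + s * I)‖ ^ 2 *
        (1 + Real.log (1 + s ^ 2)))
      ≤ ∫⁻ s : ℝ, ENNReal.ofReal (K * (1 + |s + c|) ^ (-(3 / 2 : ℝ))) :=
        lintegral_mono fun s ↦ ENNReal.ofReal_le_ofReal (hpt s)
    _ < ∞ := hint.lintegral_lt_top

/-- Each `χ_n` lies in the form domain (`U^n ∈ Dom(QW_λ)`). [cite: ConnesConsani2023, proof of Lemma 2.2 (U^n belongs to the domain of Q_∞), p. 104 (arXiv chunk p0007:L1–L2)] -/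
theorem chi_mem_formDomain (ha : 0 < a) (n : ℤ) : Yoshida1992.chi a n ∈ formDomain a :=
  ⟨memLp_chi a n, support_chi_subset a n, logSobolevEnergy_chi_lt_top ha n⟩

end FiniteSections

/-! ## §J `E_N ⊆ Dom(QW_λ)` and the monotone half of Cor. 2.4 -/

section MonotoneHalf

variable {a : ℝ}

/-- Energy of a scalar multiple: `‖(cξ)^‖₁² = |c|² ‖ξ̂‖₁²`. [cite: ConnesConsani2023, proof of Lemma 2.2 (the weighted norm ‖·‖₁ is a Hilbert norm; arXiv chunk p0007:L43; p. 105)] -/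
theorem logSobolevEnergy_const_mul (c : ℂ) (ξ : ℝ → ℂ) :
    logSobolevEnergy (fun x ↦ c * ξ x) = ENNReal.ofReal (‖c‖ ^ 2) * logSobolevEnergy ξ := by
  unfold logSobolevEnergy
  rw [← lintegral_const_mul' _ _ ENNReal.ofReal_ne_top]
  refine lintegral_congr fun s ↦ ?_
  rw [weilMellin_const_mul, norm_mul, mul_pow, ← ENNReal.ofReal_mul (sq_nonneg _), mul_assoc]

/-- `weilMellin` is additive on window functions. [cite: ConnesConsani2023, Prop. 2.1 (linearity on L²([λ⁻¹,λ]); arXiv chunk p0006:L55; p. 103)] -/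
theorem weilMellin_add_window {f g : ℝ → ℂ} (hf : MemLp f 2 volume)
    (hfs : Function.support f ⊆ Icc (-a) a) (hg : MemLp g 2 volume)
    (hgs : Function.support g ⊆ Icc (-a) a) (s : ℂ) :
    weilMellin (fun x ↦ f x + g x) s = weilMellin f s + weilMellin g s := by
  unfold weilMellin
  rw [← integral_add (integrable_mul_cexp_window hf hfs _) (integrable_mul_cexp_window hg hgs _)]
  congr 1 with t
  ring

/-- The energy of a sum of two window functions of finite energy is finite
(`|f̂ + ĝ|² ≤ 2|f̂|² + 2|ĝ|²`). [cite: ConnesConsani2023, proof of Lemma 2.2 (the weighted norm ‖·‖₁ is a Hilbert norm; arXiv chunk p0007:L43; p. 105)] -/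
theorem logSobolevEnergy_add_lt_top {f g : ℝ → ℂ} (hf : MemLp f 2 volume)
    (hfs : Function.support f ⊆ Icc (-a) a) (hg : MemLp g 2 volume)
    (hgs : Function.support g ⊆ Icc (-a) a) (hEf : logSobolevEnergy f < ∞)
    (hEg : logSobolevEnergy g < ∞) : logSobolevEnergy (fun x ↦ f x + g x) < ∞ := by
  have hf1 := integrable_of_memLp_window hf hfs
  have hmeas : AEMeasurable (fun s : ℝ ↦ 2 * ENNReal.ofReal
      (‖weilMellin f (1 / 2 + s * I)‖ ^ 2 * (1 + Real.log (1 + s ^ 2)))) volume := by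
    refine (Measurable.ennreal_ofReal ?_).aemeasurable.const_mul _
    exact ((continuous_weilMellin_half_line_of_integrable hf1).norm.pow 2).measurable.mul
      (measurable_const.add ((measurable_const.add (measurable_id.pow_const 2)).log))
  have hle : logSobolevEnergy (fun x ↦ f x + g x) ≤
      2 * logSobolevEnergy f + 2 * logSobolevEnergy g := by
    unfold logSobolevEnergy
    rw [← lintegral_const_mul' _ _ (by norm_num), ← lintegral_const_mul' _ _ (by norm_num),
      ← lintegral_add_left' hmeas]
    refine lintegral_mono fun s ↦ ?_
    have hw := logWeight_nonneg' s
    rw [weilMellin_add_window hf hfs hg hgs, show (2 : ℝ≥0∞) = ENNReal.ofReal 2 by norm_num,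
      ← ENNReal.ofReal_mul zero_le_two, ← ENNReal.ofReal_mul zero_le_two,
      ← ENNReal.ofReal_add (by positivity) (by positivity)]
    refine ENNReal.ofReal_le_ofReal ?_
    set x := weilMellin f (1 / 2 + s * I)
    set y := weilMellin g (1 / 2 + s * I)
    have h1 : ‖x + y‖ ≤ ‖x‖ + ‖y‖ := norm_add_le x y
    have h2 : ‖x + y‖ ^ 2 ≤ 2 * ‖x‖ ^ 2 + 2 * ‖y‖ ^ 2 := by
      nlinarith [norm_nonneg (x + y), norm_nonneg x, norm_nonneg y, sq_nonneg (‖x‖ - ‖y‖)]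
    nlinarith
  refine hle.trans_lt (ENNReal.add_lt_top.2 ⟨?_, ?_⟩)
  · exact ENNReal.mul_lt_top (by norm_num) hEf
  · exact ENNReal.mul_lt_top (by norm_num) hEg

/-- The form domain is closed under addition. [cite: ConnesConsani2023, Prop. 2.1 (Dom(QW_λ) is a linear subspace; arXiv chunk p0006:L39; p. 102)] -/
theorem add_mem_formDomain {f g : ℝ → ℂ} (hf : f ∈ formDomain a) (hg : g ∈ formDomain a) :
    (fun x ↦ f x + g x) ∈ formDomain a := by
  refine ⟨hf.1.add hg.1, ?_, logSobolevEnergy_add_lt_top hf.1 hf.2.1 hg.1 hg.2.1 hf.2.2 hg.2.2⟩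
  intro x hx
  by_contra h
  exact hx (by simp [eq_zero_of_support_subset hf.2.1 h, eq_zero_of_support_subset hg.2.1 h])

/-- The form domain is closed under scalars. [cite: ConnesConsani2023, Prop. 2.1 (Dom(QW_λ) is a linear subspace; arXiv chunk p0006:L39; p. 102)] -/
theorem const_mul_mem_formDomain (c : ℂ) {f : ℝ → ℂ} (hf : f ∈ formDomain a) :
    (fun x ↦ c * f x) ∈ formDomain a := by
  refine ⟨hf.1.const_mul c, ?_, ?_⟩
  · intro x hx
    by_contra h
    exact hx (by simp [eq_zero_of_support_subset hf.2.1 h])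
  · rw [logSobolevEnergy_const_mul]
    exact ENNReal.mul_lt_top ENNReal.ofReal_lt_top hf.2.2

/-- `0` lies in the form domain. [cite: ConnesConsani2023, Prop. 2.1 (Dom(QW_λ) is a linear subspace; arXiv chunk p0006:L39; p. 102)] -/
theorem zero_mem_formDomain (a : ℝ) : (0 : ℝ → ℂ) ∈ formDomain a := by
  refine ⟨MemLp.zero, by simp, ?_⟩
  unfold logSobolevEnergy
  have h0 : ∀ s : ℂ, weilMellin (0 : ℝ → ℂ) s = 0 := fun s ↦ by simp [weilMellin]
  simp [h0]

/-- **`E_N ⊆ Dom(QW_λ)`**: every Laurent polynomial in `U` lies in the form domain (each `U^n` does, by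
(2.13), and the domain is a linear space). [cite: ConnesConsani2023, proof of Lemma 2.2 (U^n ∈ Dom(Q_∞)), p. 104 (arXiv chunk p0007:L1–L2)] -/
theorem mem_formDomain_of_mem_W (ha : 0 < a) {N : ℕ} {η : ℝ → ℂ} (hη : η ∈ Yoshida1992.W a N) :
    η ∈ formDomain a := by
  induction hη using Submodule.span_induction with
  | mem x hx =>
      obtain ⟨n, rfl⟩ := hx
      exact chi_mem_formDomain ha _
  | zero => exact zero_mem_formDomain a
  | add x y _ _ hx hy => exact add_mem_formDomain hx hy
  | smul c x _ hx => exact const_mul_mem_formDomain c hx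

/-- `∫ |χ_0|² = 1` (the `χ_n` are normalised). [cite: ConnesConsani2023, Lemma 2.6 (the η_j form an orthonormal basis of E_n; arXiv chunk p0008:L55; p. 108)] -/
theorem integral_norm_sq_chi_zero (ha : 0 < a) : ∫ x, ‖Yoshida1992.chi a 0 x‖ ^ 2 = 1 := by
  have e : (fun x ↦ ‖Yoshida1992.chi a 0 x‖ ^ 2) = (Icc (-a) a).indicator (fun _ ↦ 1 / (2 * a)) := by
    funext x
    by_cases hx : x ∈ Icc (-a) a
    · simp only [Yoshida1992.chi, indicator_of_mem hx, Yoshida1992.chiCore, Int.cast_zero, mul_zero,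
        zero_mul, zero_div, Complex.exp_zero, mul_one, Complex.norm_real, Real.norm_eq_abs]
      rw [abs_of_pos (by positivity), div_pow, one_pow, Real.sq_sqrt (by positivity)]
    · simp [Yoshida1992.chi, indicator_of_notMem hx]
  rw [e, integral_indicator measurableSet_Icc, setIntegral_const, smul_eq_mul,
    Real.volume_real_Icc_of_le (by linarith)]
  field_simp
  ring

/-- `χ_0 ∈ E_N`. [cite: ConnesConsani2023, Cor. 2.4 (E_N = span of U^k, |k| ≤ N ∋ U^0), p. 106 (arXiv chunk p0007:L82)] -/
theorem chi_zero_mem_W (a : ℝ) (N : ℕ) : Yoshida1992.chi a 0 ∈ Yoshida1992.W a N :=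
  Submodule.subset_span ⟨⟨0, by simp [Yoshida1992.mem_modes]⟩, rfl⟩

/-- The values of the form on the unit sphere of the form domain are bounded below (from
`semilocalWeilForm_lower_bound`). [cite: ConnesConsani2023, Prop. 2.1 (lower bounded), p. 103 (arXiv chunk p0006:L55)] -/
theorem bddBelow_formDomain_values (ha : 0 < a) :
    BddBelow {x : ℝ | ∃ ξ ∈ formDomain a, ∫ t, ‖ξ t‖ ^ 2 = (1 : ℝ) ∧
      x = weilFinitePrimeQuadratic (primeCutoff a) ξ} := by
  obtain ⟨c, hc⟩ := semilocalWeilForm_lower_bound ha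
  refine ⟨-c, ?_⟩
  rintro x ⟨ξ, hξ, hnorm, rfl⟩
  have h := hc ξ hξ.1 hξ.2.1
  rw [hnorm, mul_one, semilocalWeilForm_of_mem_formDomain hξ, EReal.coe_le_coe_iff] at h
  exact h

/-- The finite-section values are among the form-domain values (`E_N ⊆ Dom`). [cite: ConnesConsani2023, Cor. 2.4, p. 106 (arXiv chunk p0007:L82)] -/
theorem finiteSection_values_subset (ha : 0 < a) (N : ℕ) :
    {x : ℝ | ∃ η ∈ Yoshida1992.W a N, ∫ t, ‖η t‖ ^ 2 = (1 : ℝ) ∧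
        x = weilFinitePrimeQuadratic (primeCutoff a) η} ⊆
      {x : ℝ | ∃ ξ ∈ formDomain a, ∫ t, ‖ξ t‖ ^ 2 = (1 : ℝ) ∧
        x = weilFinitePrimeQuadratic (primeCutoff a) ξ} := by
  rintro x ⟨η, hη, hnorm, rfl⟩
  exact ⟨η, mem_formDomain_of_mem_W ha hη, hnorm, rfl⟩

/-- The finite-section value sets are nonempty (`χ_0 ∈ E_N` is a unit vector). [cite: ConnesConsani2023, Cor. 2.4, p. 106 (arXiv chunk p0007:L82)] -/
theorem finiteSection_values_nonempty (ha : 0 < a) (N : ℕ) :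
    {x : ℝ | ∃ η ∈ Yoshida1992.W a N, ∫ t, ‖η t‖ ^ 2 = (1 : ℝ) ∧
        x = weilFinitePrimeQuadratic (primeCutoff a) η}.Nonempty :=
  ⟨_, Yoshida1992.chi a 0, chi_zero_mem_W a N, integral_norm_sq_chi_zero ha, rfl⟩

/-- The finite-section value sets increase with `N`. [cite: ConnesConsani2023, Cor. 2.4 (E_N ⊆ E_{N+1}), p. 106 (arXiv chunk p0007:L82)] -/
theorem finiteSection_values_mono (a : ℝ) {N M : ℕ} (h : N ≤ M) :
    {x : ℝ | ∃ η ∈ Yoshida1992.W a N, ∫ t, ‖η t‖ ^ 2 = (1 : ℝ) ∧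
        x = weilFinitePrimeQuadratic (primeCutoff a) η} ⊆
      {x : ℝ | ∃ η ∈ Yoshida1992.W a M, ∫ t, ‖η t‖ ^ 2 = (1 : ℝ) ∧
        x = weilFinitePrimeQuadratic (primeCutoff a) η} := by
  rintro x ⟨η, hη, hnorm, rfl⟩
  exact ⟨η, W_mono a h hη, hnorm, rfl⟩

/-- **The lower bound of `QW_λ` is below every finite-section minimum**: `formLowerBound a ≤ λ_min(E_N)`.
[cite: ConnesConsani2023, Cor. 2.4, p. 106 (arXiv chunk p0007:L82)] -/
theorem formLowerBound_le_finiteSectionMin (ha : 0 < a) (N : ℕ) :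
    formLowerBound a ≤ finiteSectionMin a N :=
  csInf_le_csInf (bddBelow_formDomain_values ha) (finiteSection_values_nonempty ha N)
    (finiteSection_values_subset ha N)

/-- **The finite-section minima decrease**: `λ_min(E_{N+1}) ≤ λ_min(E_N)`. [cite: ConnesConsani2023, Cor. 2.4, p. 106 (arXiv chunk p0007:L82)] -/
theorem finiteSectionMin_antitone (ha : 0 < a) : Antitone (finiteSectionMin a) := fun N M h ↦
  csInf_le_csInf ((bddBelow_formDomain_values ha).mono (finiteSection_values_subset ha M))
    (finiteSection_values_nonempty ha N) (finiteSection_values_mono a h)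

/-- **Monotone half of Cor. 2.4** (PROVED): the smallest eigenvalues `λ_min(E_N)` of the finite
sections decrease to a limit, and that limit is `≥` the lower bound of `QW_λ`.  (The reverse inequality —
that the limit IS the lower bound — is Cor. 2.4 proper and rests on the core property Lemma 2.2,
the named fact `lemma_2_2`.) [cite: ConnesConsani2023, Cor. 2.4, p. 106 (arXiv chunk p0007:L82)] -/
theorem tendsto_finiteSectionMin_iInf (ha : 0 < a) :
    Tendsto (fun N ↦ finiteSectionMin a N) atTop (𝓝 (⨅ N, finiteSectionMin a N)) ∧
      formLowerBound a ≤ ⨅ N, finiteSectionMin a N := by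
  have hbdd : BddBelow (Set.range (finiteSectionMin a)) := by
    refine ⟨formLowerBound a, ?_⟩
    rintro _ ⟨N, rfl⟩
    exact formLowerBound_le_finiteSectionMin ha N
  exact ⟨tendsto_atTop_ciInf (finiteSectionMin_antitone ha) hbdd,
    le_ciInf fun N ↦ formLowerBound_le_finiteSectionMin ha N⟩

end MonotoneHalf

/-! ## §K Growth of `‖Û^n‖₁²` in `n` (input of the Fourier-truncation step (2.19) of Lemma 2.2) -/

section ChiEnergyGrowth

variable {a : ℝ}

/-- **Polynomial growth of the log-energy of the exponentials**: there is `C = C(a)` with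
`‖χ̂_n‖₁² ≤ C (1 + |n|)` for all `n ∈ ℤ` (the paper proves the sharper `‖Û^k‖₁² = O(log|k|)`; any
polynomial bound suffices against the rapid decay of the Fourier coefficients of a smooth function,
which is how (2.19) is used). Same majorant as `logSobolevEnergy_chi_lt_top`:
`|χ̂_n(1/2+it)|²(1+log(1+t²)) ≤ K_n (1+|t+πn/a|)^{-3/2}` with `K_n = 10(4a+4/a)√(1+π|n|/a)`.
[cite: ConnesConsani2023, proof of Lemma 2.2 (‖Û^k‖₁² = O(log|k|), the display before (2.19)), p. 105 (arXiv chunk p0007:L52–L58)] -/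
theorem exists_logSobolevEnergy_chi_le (ha : 0 < a) :
    ∃ C : ℝ, 0 ≤ C ∧ ∀ n : ℤ,
      logSobolevEnergy (Yoshida1992.chi a n) ≤ ENNReal.ofReal (C * (1 + |(n : ℝ)|)) := by
  set I0 : ℝ := ∫ s : ℝ, (1 + |s|) ^ (-(3 / 2 : ℝ)) with hI0
  have hI0nn : 0 ≤ I0 := integral_nonneg fun s ↦ by positivity
  refine ⟨(4 * a + 4 / a) * 5 * 2 * (1 + π / a) * I0, by positivity, fun n ↦ ?_⟩
  set c : ℝ := π * n / a with hc
  have hA : 0 < 2 * a := by positivity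
  have hmaj : ∀ t : ℝ, ‖weilMellin (Yoshida1992.chi a n) (1 / 2 + t * I)‖ ^ 2 ≤
      (4 * a + 4 / a) / (1 + (t + c) ^ 2) := by
    intro t
    have hsq := norm_weilMellin_chi_le_sqrt ha n t
    have hnn := norm_nonneg (weilMellin (Yoshida1992.chi a n) (1 / 2 + t * I))
    by_cases hsmall : (t + c) ^ 2 ≤ 1
    · have h1 : ‖weilMellin (Yoshida1992.chi a n) (1 / 2 + t * I)‖ ^ 2 ≤ 2 * a := by
        calc _ ≤ Real.sqrt (2 * a) ^ 2 := pow_le_pow_left₀ hnn hsq 2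
          _ = 2 * a := Real.sq_sqrt hA.le
      rw [le_div_iff₀ (by positivity)]
      have h4a : 0 < 4 / a := by positivity
      nlinarith
    · rw [not_le] at hsmall
      have hne : π * n / a + t ≠ 0 := by
        intro h0
        have : (t + c) ^ 2 = 0 := by rw [hc, add_comm, h0]; ring
        linarith
      have hinv := norm_weilMellin_chi_le_inv ha n hne
      have habs : |π * n / a + t| = |t + c| := by rw [hc, add_comm]
      rw [habs] at hinv
      have hpos : 0 < |t + c| := by
        rw [abs_pos]; intro h0; rw [h0] at hsmall; norm_num at hsmall
      have h1 : ‖weilMellin (Yoshida1992.chi a n) (1 / 2 + t * I)‖ ^ 2 ≤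
          (1 / Real.sqrt (2 * a) * (2 / |t + c|)) ^ 2 :=
        pow_le_pow_left₀ hnn hinv 2
      have h2 : (1 / Real.sqrt (2 * a) * (2 / |t + c|)) ^ 2 = 2 / (a * (t + c) ^ 2) := by
        rw [mul_pow, div_pow, div_pow, one_pow, Real.sq_sqrt hA.le, sq_abs]
        field_simp
      rw [h2] at h1
      refine h1.trans ?_
      rw [div_le_div_iff₀ (by positivity) (by positivity)]
      have e3 : (4 * a + 4 / a) * (a * (t + c) ^ 2) = (4 * a ^ 2 + 4) * (t + c) ^ 2 := by
        field_simp
      rw [e3]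
      nlinarith [hsmall, sq_nonneg a, sq_nonneg (t + c)]
  have hlog : ∀ t : ℝ, 1 + Real.log (1 + t ^ 2) ≤
      5 * Real.sqrt (1 + |c|) * (1 + |t + c|) ^ ((1 : ℝ) / 2) := by
    intro t
    refine (logWeight_le_rpow t).trans ?_
    have h1 : (1 + t ^ 2) ^ ((1 : ℝ) / 4) ≤ ((1 + |c|) * (1 + |t + c|)) ^ ((1 : ℝ) / 2) := by
      have e : ((1 + |c|) * (1 + |t + c|)) ^ ((1 : ℝ) / 2) =
          (((1 + |c|) * (1 + |t + c|)) ^ (2 : ℝ)) ^ ((1 : ℝ) / 4) := by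
        rw [← Real.rpow_mul (by positivity)]; norm_num
      rw [e]
      refine Real.rpow_le_rpow (by positivity) ?_ (by norm_num)
      have ht : |t| ≤ |t + c| + |c| := by simpa using abs_sub (t + c) c
      rw [Real.rpow_two]
      nlinarith [sq_abs t, abs_nonneg t, abs_nonneg c, abs_nonneg (t + c),
        mul_nonneg (abs_nonneg c) (abs_nonneg (t + c))]
    have h2 : ((1 + |c|) * (1 + |t + c|)) ^ ((1 : ℝ) / 2) =
        Real.sqrt (1 + |c|) * (1 + |t + c|) ^ ((1 : ℝ) / 2) := by
      rw [Real.mul_rpow (by positivity) (by positivity), Real.sqrt_eq_rpow]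
    rw [h2] at h1
    linarith
  set K : ℝ := (4 * a + 4 / a) * (5 * Real.sqrt (1 + |c|)) * 2 with hK
  have hKnn : 0 ≤ K := by positivity
  have hpt : ∀ t : ℝ, ‖weilMellin (Yoshida1992.chi a n) (1 / 2 + t * I)‖ ^ 2 *
      (1 + Real.log (1 + t ^ 2)) ≤ K * (1 + |t + c|) ^ (-(3 / 2 : ℝ)) := by
    intro t
    have hw := logWeight_nonneg' t
    have hm := hmaj t
    have hl := hlog t
    have hs : 0 ≤ 1 + |t + c| := by positivity
    have hstep1 : ‖weilMellin (Yoshida1992.chi a n) (1 / 2 + t * I)‖ ^ 2 * (1 + Real.log (1 + t ^ 2))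
        ≤ (4 * a + 4 / a) / (1 + (t + c) ^ 2) * (5 * Real.sqrt (1 + |c|) * (1 + |t + c|) ^ ((1 : ℝ) / 2)) :=
      mul_le_mul hm hl hw (by positivity)
    refine hstep1.trans ?_
    have hq : 1 / (1 + (t + c) ^ 2) ≤ 2 * (1 + |t + c|) ^ (-(2 : ℝ)) := by
      rw [Real.rpow_neg hs, Real.rpow_two, ← div_eq_mul_inv, div_le_div_iff₀ (by positivity) (by positivity)]
      nlinarith [sq_abs (t + c), abs_nonneg (t + c), sq_nonneg (|t + c| - 1)]
    have hexp : (1 + |t + c|) ^ (-(2 : ℝ)) * (1 + |t + c|) ^ ((1 : ℝ) / 2) =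
        (1 + |t + c|) ^ (-(3 / 2 : ℝ)) := by
      rw [← Real.rpow_add (by positivity)]; norm_num
    calc (4 * a + 4 / a) / (1 + (t + c) ^ 2) * (5 * Real.sqrt (1 + |c|) * (1 + |t + c|) ^ ((1 : ℝ) / 2))
        = (4 * a + 4 / a) * (5 * Real.sqrt (1 + |c|)) *
            (1 / (1 + (t + c) ^ 2) * (1 + |t + c|) ^ ((1 : ℝ) / 2)) := by ring
      _ ≤ (4 * a + 4 / a) * (5 * Real.sqrt (1 + |c|)) *
            (2 * (1 + |t + c|) ^ (-(2 : ℝ)) * (1 + |t + c|) ^ ((1 : ℝ) / 2)) := by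
          gcongr
      _ = K * (1 + |t + c|) ^ (-(3 / 2 : ℝ)) := by rw [hK, ← hexp]; ring
  -- integrate the majorant: shift invariance of Lebesgue measure
  have hint : Integrable fun t : ℝ ↦ (1 + |t + c|) ^ (-(3 / 2 : ℝ)) := integrable_shift_rpow c
  have hshift : ∫ t : ℝ, (1 + |t + c|) ^ (-(3 / 2 : ℝ)) = I0 := by
    rw [hI0]
    exact integral_add_right_eq_self (fun s : ℝ ↦ (1 + |s|) ^ (-(3 / 2 : ℝ))) c
  have hmajint : ∫⁻ s : ℝ, ENNReal.ofReal (K * (1 + |s + c|) ^ (-(3 / 2 : ℝ))) =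
      ENNReal.ofReal (K * I0) := by
    rw [← hshift, ← integral_const_mul,
      ofReal_integral_eq_lintegral_ofReal (hint.const_mul K)
        (Eventually.of_forall fun s ↦ by positivity)]
  -- `√(1+|c|) ≤ 1 + |c| ≤ (1 + π/a)(1 + |n|)`
  have hsqrt : Real.sqrt (1 + |c|) ≤ (1 + π / a) * (1 + |(n : ℝ)|) := by
    have h1 : Real.sqrt (1 + |c|) ≤ 1 + |c| := by
      rw [Real.sqrt_le_left (by positivity)]
      nlinarith [abs_nonneg c]
    have h2 : |c| = π / a * |(n : ℝ)| := by
      rw [hc, show π * (n : ℝ) / a = π / a * n by ring, abs_mul, abs_of_pos (by positivity)]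
    have h3 : 1 + |c| ≤ (1 + π / a) * (1 + |(n : ℝ)|) := by
      rw [h2]
      have hpa : 0 ≤ π / a := by positivity
      nlinarith [abs_nonneg (n : ℝ)]
    exact h1.trans h3
  have hKle : K * I0 ≤ (4 * a + 4 / a) * 5 * 2 * (1 + π / a) * I0 * (1 + |(n : ℝ)|) := by
    rw [hK]
    have h4 : 0 ≤ 4 * a + 4 / a := by positivity
    calc (4 * a + 4 / a) * (5 * Real.sqrt (1 + |c|)) * 2 * I0
        = ((4 * a + 4 / a) * 5 * 2 * I0) * Real.sqrt (1 + |c|) := by ring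
      _ ≤ ((4 * a + 4 / a) * 5 * 2 * I0) * ((1 + π / a) * (1 + |(n : ℝ)|)) :=
          mul_le_mul_of_nonneg_left hsqrt (by positivity)
      _ = _ := by ring
  unfold logSobolevEnergy
  calc ∫⁻ s : ℝ, ENNReal.ofReal (‖weilMellin (Yoshida1992.chi a n) (1 / 2 + s * I)‖ ^ 2 *
        (1 + Real.log (1 + s ^ 2)))
      ≤ ∫⁻ s : ℝ, ENNReal.ofReal (K * (1 + |s + c|) ^ (-(3 / 2 : ℝ))) :=
        lintegral_mono fun s ↦ ENNReal.ofReal_le_ofReal (hpt s)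
    _ = ENNReal.ofReal (K * I0) := hmajint
    _ ≤ _ := ENNReal.ofReal_le_ofReal hKle

end ChiEnergyGrowth

end Literature.NumberTheory.ConnesConsani2023

end
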